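import Summits.QuantumFields.YangMills.Theorems.LuscherReductionTwistedTraceScalingBTColourFP
import Literature.MathematicalPhysics.QuantumFieldTheory.Balaban1983to89.T4HaarSU2Translate
import HarnessLib

/-!
# The Faddeev–Popov WEIGHT OF RECORD for the global colour action: the equivariant polar COLOUR MEAN of a gauge transformation and the indicator of a colour ball
# (lane A of S-BASE, crux `TwistedTraceScaling` stmt-QuantumFields-20203, C4-CORE, the (B-T) pen; design note `pub/ym-fleet/ym-luscher-20007-p1/COARSE-DESIGN.md` §25.2, §25.4 (F0))

`…BTColourFP` proved the Faddeev–Popov identity `Z·∫F dg = ∫_c∫_g F(c·g)W(g) dg dc` for every weight `W` with constant colour-orbit integral, and `boKernel_fp` for such `W`.  This file fixes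
the weight of record:
* `colourQuatSum g = Σ_x q(g_x) ∈ ℍ` and the **polar colour mean** `colourMean g = quatToSU2 (Σ_x q(g_x))` (junk `g 0` on the null set where the sum vanishes), EQUIVARIANT under the global
  colour action (`colourMean_constMul`: `colourMean (c·g) = c·colourMean g`, from `mul_quatToSU2`) and measurable;
* the colour ball `fpBall ε = {c | ‖q(c) − 1‖ < ε}` (open, contains `1`), the weight `fpWeight ε g = 𝟙{colourMean g ∈ fpBall ε}` and `fpZ ε = Haar(fpBall ε) > 0` (`fpZ_pos`);
* ★ `fpWeight_orbit` — `∫_c fpWeight ε (c·g) dc = fpZ ε` for EVERY `g` (so `fpWeight ε` is an FP weight), and ★★ `boKernel_fp_record` — `fpZ ε · 𝒦_β(u,u') = ∫_c fpBOKernel β Ω (fpWeight ε) (c⁻¹uc) u' dc`.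
In the orthographic chart `g_x = chartSU2 ξ_x` the slice `colourMean g = 1` is EXACTLY the linear condition `Σ_x ξ_x = 0` (the vector part of the quaternion sum is `Σ_x ξ_x`), which is what
kills the linear term of the Laplace phase (§25.2); the record radius is `ε = β^{-1}`.
HONEST FRAMING: definitions + symmetry bookkeeping; the Laplace core of (B-T) is OPEN; C4-CORE OPEN; stub of a child of the CONDITIONAL route R2b1; not infinite volume, not a gap, not Clay.
-/

set_option autoImplicit false

noncomputable section

open MeasureTheory Filter Topology Real
open scoped BigOperators Quaternion
open Literature.MathematicalPhysics.QuantumFieldTheory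
open Literature.MathematicalPhysics.QuantumLattice

attribute [local instance] Literature.Analysis.FluidPDE.Tao2016.quatMeasurableSpace
  Literature.Analysis.FluidPDE.Tao2016.quatBorelSpace

namespace Summit.QuantumFields.YangMills.Theorems.FemtoTransferGap.TwoLattice.ConstTube

open Summit.QuantumFields.YangMills.Theorems.FemtoTransferGap
open Summit.QuantumFields.YangMills.Theorems.FemtoTransferGap.TwoLattice.Avg
open Summit.QuantumFields.YangMills.Theorems.FemtoTransferGap.TwoLattice.Stiff (LinkSpace)
open Literature.MathematicalPhysics.QuantumFieldTheory.Balaban1983to89.T4HaarSU2Translate (continuous_su2Quat su2Quat_one)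

variable (L : ℕ) [NeZero L]

/-! ## §1 The polar colour mean -/

/-- The quaternion sum `Σ_x q(g_x)` of a gauge transformation. [folklore] -/
def colourQuatSum (g : Site 3 L → SU2) : ℍ := ∑ x : Site 3 L, su2Quat (g x)

open scoped Classical in
/-- **The polar colour mean** `quatToSU2 (Σ_x q(g_x))` (junk `g 0` where the sum vanishes, which keeps equivariance everywhere). [cite: Luscher1983, §3] -/
def colourMean (g : Site 3 L → SU2) : SU2 := if colourQuatSum L g = 0 then g 0 else quatToSU2 (colourQuatSum L g)

/-- The quaternion sum is left-equivariant: `Σ_x q(c·g_x) = q(c)·Σ_x q(g_x)`. [folklore] -/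
theorem colourQuatSum_constMul (c : SU2) (g : Site 3 L → SU2) : colourQuatSum L (fun x => c * g x) = su2Quat c * colourQuatSum L g := by
  unfold colourQuatSum
  rw [Finset.mul_sum]
  exact Finset.sum_congr rfl fun x _ => Literature.MathematicalPhysics.QuantumFieldTheory.Balaban1983to89.T4HaarSU2Translate.su2Quat_mul c (g x)

/-- ★ **Equivariance of the colour mean**: `colourMean (c·g) = c · colourMean g` for every `c` and `g`. [folklore] -/
theorem colourMean_constMul (c : SU2) (g : Site 3 L → SU2) : colourMean L (fun x => c * g x) = c * colourMean L g := by
  unfold colourMean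
  rw [colourQuatSum_constMul]
  by_cases h : colourQuatSum L g = 0
  · rw [if_pos h, if_pos (by rw [h, mul_zero])]
  · have hc : su2Quat c * colourQuatSum L g ≠ 0 := mul_ne_zero (su2Quat_ne_zero c) h
    rw [if_neg h, if_neg hc, mul_quatToSU2 c h]

/-- The quaternion sum is continuous. [folklore] -/
theorem continuous_colourQuatSum : Continuous (colourQuatSum L) := by
  unfold colourQuatSum
  exact continuous_finsetSum _ fun x _ => continuous_su2Quat.comp (continuous_apply x)

/-- The colour mean is measurable. [folklore] -/
theorem measurable_colourMean : Measurable (colourMean L) := by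
  haveI : SecondCountableTopology SU2 := secondCountableTopology_su2
  have hS : Measurable (colourQuatSum L) := (continuous_colourQuatSum L).measurable
  have hset : MeasurableSet {g : Site 3 L → SU2 | colourQuatSum L g = 0} := hS (measurableSet_singleton 0)
  unfold colourMean
  exact Measurable.ite hset (measurable_pi_apply 0) (measurable_quatToSU2.comp hS)

/-! ## §2 The colour ball, the weight and its normalisation -/

/-- The colour ball `{c ∈ SU(2) | ‖q(c) − 1‖ < ε}`. [folklore] -/
def fpBall (ε : ℝ) : Set SU2 := {c | ‖su2Quat c - 1‖ < ε}

/-- The colour ball is open. [folklore] -/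
theorem isOpen_fpBall (ε : ℝ) : IsOpen (fpBall ε) :=
  isOpen_lt (continuous_norm.comp (continuous_su2Quat.sub continuous_const)) continuous_const

/-- The colour ball is measurable. [folklore] -/
theorem measurableSet_fpBall (ε : ℝ) : MeasurableSet (fpBall ε) := (isOpen_fpBall ε).measurableSet

/-- `1 ∈ fpBall ε` for `ε > 0`. [folklore] -/
theorem one_mem_fpBall {ε : ℝ} (hε : 0 < ε) : (1 : SU2) ∈ fpBall ε := by
  show ‖su2Quat 1 - 1‖ < ε
  rw [su2Quat_one, sub_self, norm_zero]; exact hε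

/-- **The FP weight of record**: `fpWeight ε g = 𝟙{colourMean g ∈ fpBall ε}`. [cite: Luscher1983, §3] -/
def fpWeight (ε : ℝ) (g : Site 3 L → SU2) : ℝ := (fpBall ε).indicator (fun _ => (1 : ℝ)) (colourMean L g)

/-- **Its normalisation** `fpZ ε = Haar(fpBall ε)`. [folklore] -/
def fpZ (ε : ℝ) : ℝ := (haarProbability SU2).real (fpBall ε)

/-- `fpZ ε > 0` for `ε > 0` (Haar charges non-empty open sets). [folklore] -/
theorem fpZ_pos {ε : ℝ} (hε : 0 < ε) : 0 < fpZ ε := by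
  haveI : (haarProbability SU2).IsOpenPosMeasure := by unfold haarProbability; infer_instance
  unfold fpZ
  exact ENNReal.toReal_pos ((isOpen_fpBall ε).measure_pos _ ⟨1, one_mem_fpBall hε⟩).ne' (measure_ne_top _ _)

/-- `fpZ ε = ∫ 𝟙_{fpBall ε} dHaar`. [folklore] -/
theorem fpZ_eq_integral (ε : ℝ) : fpZ ε = ∫ c, (fpBall ε).indicator (fun _ => (1 : ℝ)) c ∂haarProbability SU2 := by
  rw [integral_indicator (measurableSet_fpBall ε), setIntegral_const, smul_eq_mul, mul_one]
  rfl

/-- The weight is measurable. [folklore] -/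
theorem measurable_fpWeight (ε : ℝ) : Measurable (fpWeight L ε) :=
  ((measurable_const.indicator (measurableSet_fpBall ε)).comp (measurable_colourMean L))

/-- `0 ≤ fpWeight ≤ 1`. [folklore] -/
theorem fpWeight_mem_Icc (ε : ℝ) (g : Site 3 L → SU2) : 0 ≤ fpWeight L ε g ∧ fpWeight L ε g ≤ 1 := by
  unfold fpWeight
  by_cases h : colourMean L g ∈ fpBall ε
  · rw [Set.indicator_of_mem h]; exact ⟨zero_le_one, le_rfl⟩
  · rw [Set.indicator_of_notMem h]; exact ⟨le_rfl, zero_le_one⟩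

/-- `|fpWeight| ≤ 1`. [folklore] -/
theorem abs_fpWeight_le (ε : ℝ) (g : Site 3 L → SU2) : |fpWeight L ε g| ≤ 1 := by
  obtain ⟨h0, h1⟩ := fpWeight_mem_Icc L ε g
  rw [abs_of_nonneg h0]; exact h1

/-- ★ **`fpWeight ε` is a Faddeev–Popov weight**: `∫_c fpWeight ε (c·g) dc = fpZ ε` for every `g`. [cite: Luscher1983, §3] -/
theorem fpWeight_orbit (ε : ℝ) (g : Site 3 L → SU2) : ∫ c, fpWeight L ε (fun x => c * g x) ∂haarProbability SU2 = fpZ ε := by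
  unfold fpWeight
  rw [fp_weight_of_equivariant (L := L) ((fpBall ε).indicator fun _ => (1 : ℝ)) (colourMean_constMul L) g, fpZ_eq_integral]

/-! ## §3 The localised BO kernel of record -/

variable {L}

/-- ★★ **`fpZ ε · 𝒦_β(u,u') = ∫_c fpBOKernel β Ω (fpWeight ε) (c⁻¹uc, u') dc`** for colour-blind bounded measurable `Ω` (and integrability of the integrand in `c`).
[cite: Luscher1983, §3] -/
theorem boKernel_fp_record (β ε : ℝ) {Ω : LinkSpace L → ℝ} (hΩm : Measurable Ω) {CΩ : ℝ} (hCΩ : ∀ x, |Ω x| ≤ CΩ)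
    (hΩinv : ∀ (g : SU2) (x : LinkSpace L), Ω (adL L g x) = Ω x) (u u' : GaugeConfig 3 1 SU2) :
    Integrable (fun c : SU2 => fpBOKernel L β Ω (fpWeight L ε) (gaugeTransform (fun _ : Site 3 1 => c⁻¹) u) u') (haarProbability SU2) ∧
      fpZ ε * boKernel L β Ω u u' = ∫ c, fpBOKernel L β Ω (fpWeight L ε) (gaugeTransform (fun _ : Site 3 1 => c⁻¹) u) u' ∂haarProbability SU2 :=
  boKernel_fp β hΩm hCΩ hΩinv (measurable_fpWeight L ε) (abs_fpWeight_le L ε) (fpWeight_orbit L ε) u u'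

end Summit.QuantumFields.YangMills.Theorems.FemtoTransferGap.TwoLattice.ConstTube

end
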